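import Mathlib
import Literature.Computability.AlgebraicComplexity.FixedPointLog
import Summits.RiemannHypothesis.RiemannHypothesis.Theorems.WeilFormatCJointShiftSOS
import Summits.RiemannHypothesis.RiemannHypothesis.Theorems.WeilFormatCJointShiftCert
import Summits.RiemannHypothesis.RiemannHypothesis.Theorems.WeilFormatCJointShiftCertBrackets
import Summits.RiemannHypothesis.RiemannHypothesis.Theorems.WeilFormatCCellShiftCert
import Summits.RiemannHypothesis.RiemannHypothesis.Theorems.WeilFormatCCellShiftCertCells
import HarnessLib

/-!
# Cell-refined shift certificate (route K3): facts about the piece correlations `X(γ, k, l)`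

Helper file (`--supports stmt-RiemannHypothesis-0098`), RH-free; seat rh-explicit-weil-1 gen3.  Continuation of
`WeilFormatCCellShiftCertCells.lean`: `|X| ≤ ∫ f²` (`abs_X_le`), the key symmetry `X(−γ,l,k) = X(γ,k,l)` (`X_swap`,
`X_ckey`), and the vanishing of ADMISSIBLE classes (`X_eq_zero_of_adm`: certified `γ·ℓ > 2h(l−k+1)` or
`γ·ℓ < 2h(l−k−1)` via the tree's logarithm enclosures, or disjoint cells).  Standard axioms only.
-/

set_option linter.dupNamespace false

noncomputable section

namespace Summit.RiemannHypothesis.RiemannHypothesis.Theorems.WeilFormatC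

namespace CellSOS

open MeasureTheory Set Finset JointSOS
open scoped Real BigOperators

namespace Cert

variable {c : Cert} {f : ℝ → ℝ} {C : ℝ}

/-! ### Facts about the correlations `X` -/

section XFacts

/-- `|X(γ,k,l)| ≤ ∫ f²`. -/
theorem abs_X_le (hf : Measurable f) (hC : ∀ x, |f x| ≤ C) (hsupp : ∀ x, x ∉ Icc (-(c.aQ : ℝ)) c.aQ → f x = 0)
    (κ : CKey) : |c.X f κ| ≤ ∫ x, f x ^ 2 := by
  have hm := fun k ↦ measurable_piece (c := c) hf k
  have hb := fun k ↦ abs_piece_le (c := c) hC k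
  have hs := fun k ↦ piece_eq_zero_of (c := c) hsupp k
  have h := abs_integral_shift_mul_le₂ (hm κ.2.1) (hm κ.2.2) (hb κ.2.1) (hb κ.2.2) (hs κ.2.1) (hs κ.2.2)
    (c.toJ.phi κ.1)
  have hff : Integrable fun x ↦ f x ^ 2 := by
    have := integrable_shift_mul_shift₂ hf hf hC hC hsupp 0 0
    exact this.congr (Filter.Eventually.of_forall fun x ↦ by simp only [sub_zero]; ring)
  have hle : ∀ k, ∫ x, c.piece f k x ^ 2 ≤ ∫ x, f x ^ 2 := fun k ↦
    integral_mono_of_nonneg (Filter.Eventually.of_forall fun x ↦ sq_nonneg _) hff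
      (Filter.Eventually.of_forall fun x ↦ piece_sq_le f k x)
  unfold X
  linarith [hle κ.2.1, hle κ.2.2]

/-- `φ(u − v) = φ(u) − φ(v)`. -/
theorem phi_vsub (u v : ZVec4) : c.toJ.phi (vsub u v) = c.toJ.phi u - c.toJ.phi v := by
  unfold JointSOS.vsub; simp only [JointSOS.Cert.phi]; push_cast; ring

/-- Key symmetry: `X(−γ, l, k) = X(γ, k, l)`. -/
theorem X_swap (f : ℝ → ℝ) (γ : ZVec4) (k l : ℕ) : c.X f (vneg γ, l, k) = c.X f (γ, k, l) := by
  unfold X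
  simp only [JointSOS.Cert.phi_vneg]
  -- ∫ f_l(x + u) f_k(x) dx = ∫ f_k(y − u) f_l(y) dy  (substitute x = y − u)
  have e2 := MeasureTheory.integral_sub_right_eq_self (μ := volume)
    (fun x ↦ c.piece f l (x - -c.toJ.phi γ) * c.piece f k x) (c.toJ.phi γ)
  rw [← e2]
  refine integral_congr_ae (Filter.Eventually.of_forall fun x ↦ ?_)
  simp only
  rw [show x - c.toJ.phi γ - -c.toJ.phi γ = x by ring, mul_comm]

/-- `X` at the canonical key equals `X` at the key. -/
theorem X_ckey (f : ℝ → ℝ) (d : ZVec4) (k l : ℕ) : c.X f (ckey d k l) = c.X f (d, k, l) := by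
  unfold ckey
  split_ifs with h0 hc
  · -- d = 0: X(0, min, max) = X(0, k, l)
    subst h0
    rcases le_total k l with hkl | hkl
    · rw [min_eq_left hkl, max_eq_right hkl]
    · rw [min_eq_right hkl, max_eq_left hkl]
      have := X_swap (c := c) f (0, 0, 0, 0) k l
      simpa [vneg] using this
  · rfl
  · rcases canon_eq_or d with h | h
    · exact absurd h hc
    · rw [h]; exact X_swap f d k l

/-- **Admissible keys vanish** (`0 < p`, `0 < aden`, hints and enclosures checked, cells `< p`). -/
theorem X_eq_zero_of_adm (f : ℝ → ℝ) (hh : c.toJ.hintsOK = true) (hl : c.toJ.logsOK = true)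
    (hden : 0 < c.aden) (hp : 0 < c.pcells) {γ : ZVec4} {k l : ℕ} (hk : k < c.pcells) (hl' : l < c.pcells)
    (hadm : c.adm γ k l = true) : c.X f (γ, k, l) = 0 := by
  unfold X
  refine (integral_congr_ae (Filter.Eventually.of_forall fun x ↦ ?_)).trans (integral_zero ℝ ℝ)
  simp only
  -- if both factors are nonzero we derive a contradiction
  by_contra hne
  have h2 : c.piece f l x ≠ 0 := fun h ↦ hne (by rw [h, mul_zero])
  have h1 : c.piece f k (x - c.toJ.phi γ) ≠ 0 := fun h ↦ hne (by rw [h, zero_mul])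
  have hx2 : x ∈ c.cell l := by
    by_contra h; exact h2 (Set.indicator_of_notMem h f)
  have hx1 : x - c.toJ.phi γ ∈ c.cell k := by
    by_contra h; exact h1 (Set.indicator_of_notMem h f)
  simp only [adm, Bool.or_eq_true, Bool.and_eq_true, decide_eq_true_eq, Bool.not_eq_true',
    decide_eq_false_iff_not] at hadm
  rcases hadm with (⟨hγ0, hkl⟩ | hlt) | hgt
  · -- γ = 0, k ≠ l: disjoint cells
    subst hγ0
    rw [JointSOS.Cert.phi_zero, sub_zero] at hx1
    exact not_mem_cell_of_mem_cell hkl hk hl' hx1 hx2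
  · -- u > 2h (l - k + 1)
    obtain ⟨b1, b2⟩ := mem_cell_bounds hk hx1
    obtain ⟨b3, b4⟩ := mem_cell_bounds hl' hx2
    have hfr : (c.toJ.freqLo γ : ℝ) ≤ (2 : ℝ) ^ c.prec * c.toJ.phi γ :=
      (JointSOS.Cert.freq_bracket (c := c.toJ) hh hl γ).1
    -- real form of the certified inequality
    have hthr : (c.thr : ℝ) = (2 : ℝ) ^ (c.prec + 1) * (c.aQ : ℝ) * (c.aden : ℝ) := by
      simp only [JointSOS.Cert.logsOK, Bool.and_eq_true, decide_eq_true_eq] at hl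
      obtain ⟨⟨_, hthr⟩, hden'⟩ := hl
      have hd : ((c.aQ.den : ℕ) : ℝ) ≠ 0 := by exact_mod_cast c.aQ.den_ne_zero
      change c.thr = 2 ^ (c.prec + 1) * c.aQ.num at hthr
      change c.aden = (c.aQ.den : ℤ) at hden'
      rw [hthr, hden']; push_cast
      rw [mul_assoc, Rat.cast_def, div_mul_cancel₀ _ hd]
    have hltR : (c.thr : ℝ) * ((l : ℝ) - k + 1) < (c.toJ.freqLo γ : ℝ) * (c.aden : ℝ) * (c.pcells : ℝ) := by
      exact_mod_cast hlt
    have hdenR : (0 : ℝ) < c.aden := by exact_mod_cast hden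
    have hpR : (0 : ℝ) < c.pcells := by exact_mod_cast hp
    have hP : (0 : ℝ) < (2 : ℝ) ^ c.prec := by positivity
    -- u ≤ lo l + cw - lo k = cw (l - k) + cw
    have hu : c.toJ.phi γ ≤ c.cw * ((l : ℝ) - k) + c.cw := by
      have := lo_sub (c := c) k l; linarith
    -- from the certificate: 2^P u · aden · p > thr (l-k+1) = 2^{P+1} aQ aden (l-k+1) ⇒ u > cw (l-k+1)
    have hcwp : c.cw * c.pcells = 2 * c.aQ := by simp only [cw]; field_simp
    have : (2 : ℝ) ^ c.prec * c.toJ.phi γ * c.aden * c.pcells > (2 : ℝ) ^ (c.prec + 1) * c.aQ * c.aden * ((l : ℝ) - k + 1) := by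
      have h1 : (c.toJ.freqLo γ : ℝ) * c.aden * c.pcells ≤ (2 : ℝ) ^ c.prec * c.toJ.phi γ * c.aden * c.pcells := by
        have := mul_le_mul_of_nonneg_right (mul_le_mul_of_nonneg_right hfr hdenR.le) hpR.le
        linarith
      rw [hthr] at hltR; linarith
    have : c.toJ.phi γ * c.pcells > 2 * c.aQ * ((l : ℝ) - k + 1) := by
      rw [pow_succ] at this
      have h4 : (2 : ℝ) ^ c.prec * (c.toJ.phi γ * c.aden * c.pcells - 2 * c.aQ * c.aden * ((l : ℝ) - k + 1)) > 0 := by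
        nlinarith
      have h5 : c.toJ.phi γ * c.aden * c.pcells - 2 * c.aQ * c.aden * ((l : ℝ) - k + 1) > 0 := by
        by_contra hcon; push Not at hcon; nlinarith
      have h6 : c.aden * (c.toJ.phi γ * c.pcells - 2 * c.aQ * ((l : ℝ) - k + 1)) > 0 := by nlinarith
      by_contra hcon; push Not at hcon; nlinarith
    -- hence u > cw (l - k + 1), contradiction with hu
    rw [← hcwp] at this
    have : c.pcells * (c.toJ.phi γ - c.cw * ((l : ℝ) - k + 1)) > 0 := by nlinarith
    have : c.toJ.phi γ - c.cw * ((l : ℝ) - k + 1) > 0 := by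
      by_contra hcon; push Not at hcon; nlinarith
    linarith
  · -- u < 2h (l - k - 1)
    obtain ⟨b1, b2⟩ := mem_cell_bounds hk hx1
    obtain ⟨b3, b4⟩ := mem_cell_bounds hl' hx2
    have hfr : (2 : ℝ) ^ c.prec * c.toJ.phi γ ≤ (c.toJ.freqHi γ : ℝ) :=
      (JointSOS.Cert.freq_bracket (c := c.toJ) hh hl γ).2
    have hthr : (c.thr : ℝ) = (2 : ℝ) ^ (c.prec + 1) * (c.aQ : ℝ) * (c.aden : ℝ) := by
      simp only [JointSOS.Cert.logsOK, Bool.and_eq_true, decide_eq_true_eq] at hl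
      obtain ⟨⟨_, hthr⟩, hden'⟩ := hl
      have hd : ((c.aQ.den : ℕ) : ℝ) ≠ 0 := by exact_mod_cast c.aQ.den_ne_zero
      change c.thr = 2 ^ (c.prec + 1) * c.aQ.num at hthr
      change c.aden = (c.aQ.den : ℤ) at hden'
      rw [hthr, hden']; push_cast
      rw [mul_assoc, Rat.cast_def, div_mul_cancel₀ _ hd]
    have hgtR : (c.toJ.freqHi γ : ℝ) * (c.aden : ℝ) * (c.pcells : ℝ) < (c.thr : ℝ) * ((l : ℝ) - k - 1) := by
      exact_mod_cast hgt
    have hdenR : (0 : ℝ) < c.aden := by exact_mod_cast hden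
    have hpR : (0 : ℝ) < c.pcells := by exact_mod_cast hp
    have hP : (0 : ℝ) < (2 : ℝ) ^ c.prec := by positivity
    -- u ≥ lo l - (lo k + cw) = cw (l - k) - cw
    have hu : c.cw * ((l : ℝ) - k) - c.cw ≤ c.toJ.phi γ := by
      have := lo_sub (c := c) k l; linarith
    have hcwp : c.cw * c.pcells = 2 * c.aQ := by simp only [cw]; field_simp
    have : (2 : ℝ) ^ c.prec * c.toJ.phi γ * c.aden * c.pcells < (2 : ℝ) ^ (c.prec + 1) * c.aQ * c.aden * ((l : ℝ) - k - 1) := by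
      have h1 : (2 : ℝ) ^ c.prec * c.toJ.phi γ * c.aden * c.pcells ≤ (c.toJ.freqHi γ : ℝ) * c.aden * c.pcells := by
        have := mul_le_mul_of_nonneg_right (mul_le_mul_of_nonneg_right hfr hdenR.le) hpR.le
        linarith
      rw [hthr] at hgtR; linarith
    have : c.toJ.phi γ * c.pcells < 2 * c.aQ * ((l : ℝ) - k - 1) := by
      rw [pow_succ] at this
      have h4 : (2 : ℝ) ^ c.prec * (2 * c.aQ * c.aden * ((l : ℝ) - k - 1) - c.toJ.phi γ * c.aden * c.pcells) > 0 := by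
        nlinarith
      have h5 : 2 * c.aQ * c.aden * ((l : ℝ) - k - 1) - c.toJ.phi γ * c.aden * c.pcells > 0 := by
        by_contra hcon; push Not at hcon; nlinarith
      have h6 : c.aden * (2 * c.aQ * ((l : ℝ) - k - 1) - c.toJ.phi γ * c.pcells) > 0 := by nlinarith
      by_contra hcon; push Not at hcon; nlinarith
    rw [← hcwp] at this
    have : c.pcells * (c.cw * ((l : ℝ) - k - 1) - c.toJ.phi γ) > 0 := by nlinarith
    have : c.cw * ((l : ℝ) - k - 1) - c.toJ.phi γ > 0 := by
      by_contra hcon; push Not at hcon; nlinarith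
    linarith

end XFacts

end Cert

end CellSOS

end Summit.RiemannHypothesis.RiemannHypothesis.Theorems.WeilFormatC
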